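import Summits.Langlands.Langlands.Theorems.PhantomRMYoshidaResiduallyYoshidaLiftingRealiserMultiplierResidual
import HarnessLib

/-!
# The primitive integral Gram form of a symplectic integral frame (stub `stub_residualGramForm`, G2) —
# line `sector-klingen-split`, crux `ResiduallyYoshidaLifting` (stmt-Langlands-13639)

Stub-worker file of lead prover-line-stmt-Langlands-13639-c5-0 (2026-08-17), skeleton rev 13, sub-goal G2, namespace
`…SectorKlingenSplit.Fibre`.

**Statement (`stub_residualGramForm`).**  Let `r : Γ → GL₄(ℚ̄_p)` be a homomorphism preserving an alternating form up to
scalars (`(r g)ᵀ J (r g) = ν g • J`, `Jᵀ = -J`, `det J ≠ 0`) and let `rint : Γ → GL₄(ℤ̄_p)` be an integral frame of `r`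
(`rint g = P⁻¹ (r g) P` over `ℚ̄_p`).  Then the Gram matrix `G = Pᵀ J P` of the frame rescales to a PRIMITIVE INTEGRAL
alternating form: there are `q ≠ 0` in `ℚ̄_p`, an integral `G₀` with `G₀ = q⁻¹ • G` over `ℚ̄_p`, `G₀ᵀ = -G₀`, non-zero
reduction `red G₀ ≠ 0` through any ring map `red : ℤ̄_p → k`, and INTEGRAL UNITS `νi g` lifting `ν g`, with
`(rint g)ᵀ G₀ (rint g) = νi g • G₀` over `ℤ̄_p`.

**Proof.**
* `G = Pᵀ J P` is invertible (`det P`, `det J ≠ 0`); `exists_integral_rescale` (p142701, lead c2-0) divides it by an entry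
  of maximal norm: `G₀` integral, `G₀ = q⁻¹ • G`, some entry `G₀ i₀ j₀ = 1` — so `red G₀ ≠ 0` (`red 1 = 1`).
* Over `ℚ̄_p`, `(rint g)ᵀ G₀ (rint g) = q⁻¹ • Pᵀ (rᵀ J r) P = ν g • G₀` (`transpose_conj_mul_form`, lead c3-0); the
  `(i₀, j₀)` entry of the INTEGRAL matrix `(rint g)ᵀ G₀ (rint g)` therefore maps to `ν g`, and serves as `νi g`; the
  matrix identity and `G₀ᵀ = -G₀` (`transpose_congr_eq_neg`) descend to `ℤ̄_p` by injectivity of `Matrix.map subtype`.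
* Units: `det G₀ ≠ 0` (its image is `q⁻⁴ det G ≠ 0`), and determinants of the integral identity give
  `det(rint g)² det G₀ = (νi g)⁴ det G₀` in the DOMAIN `ℤ̄_p`; cancel `det G₀`: `(νi g)⁴ = det(rint g)²` is a unit
  (`rint g ∈ GL₄(ℤ̄_p)`), hence so is `νi g` (`isUnit_pow_iff`).

Pure Mathlib matrix algebra on top of the two landed helper files; no named facts.
-/

noncomputable section

-- `Summit.Langlands.Langlands.…` (summit = sub-problem name, D-0017 layout) trips `dupNamespace` on every decl.
set_option linter.dupNamespace false
set_option autoImplicit false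

open scoped Matrix

namespace Summit.Langlands.Langlands.Cruxes.ResiduallyYoshidaLifting.SectorKlingenSplit.Fibre

open Summit.Langlands.Langlands.Cruxes.ResiduallyYoshidaLifting.SectorKlingenSplit.Ribet
  (exists_integral_rescale transpose_conj_mul_form transpose_congr_eq_neg)

/-! ### The multiplier of an invertible similitude of a non-degenerate form is a unit -/

/-- Over a domain, the multiplier `c` of an INVERTIBLE similitude `Mᵀ G M = c • G` of a square matrix `G` with
`det G ≠ 0` (non-empty index type) is a unit: determinants give `det M · det M · det G = c ^ n · det G`, cancel `det G`,
and `det M` is a unit. [folklore] -/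
theorem isUnit_multiplier_of_det_ne_zero {R : Type*} [CommRing R] [IsDomain R] {n : Type*} [Fintype n]
    [DecidableEq n] [Nonempty n] (M : GL n R) (G : Matrix n n R) (hG : G.det ≠ 0) (c : R)
    (h : M.valᵀ * G * M.val = c • G) : IsUnit c := by
  have e : M.val.det * M.val.det * G.det = c ^ Fintype.card n * G.det := by
    have e0 := congrArg Matrix.det h
    rw [Matrix.det_mul, Matrix.det_mul, Matrix.det_transpose, Matrix.det_smul] at e0
    rw [← e0]
    ring
  have e' : M.val.det * M.val.det = c ^ Fintype.card n := mul_right_cancel₀ hG e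
  have hM : IsUnit M.val.det := (Matrix.isUnit_iff_isUnit_det _).mp M.isUnit
  have hpow : IsUnit (c ^ Fintype.card n) := by
    rw [← e']
    exact hM.mul hM
  exact (isUnit_pow_iff Fintype.card_ne_zero).mp hpow

/-! ### Registered form -/

/-- **Registered sub-goal G2 `stub_residualGramForm`** (skeleton rev 13 of line `sector-klingen-split`): the Gram matrix
`Pᵀ J P` of a symplectic representation in an integral frame `rint = P⁻¹ r P` rescales (by an entry of maximal norm,
`exists_integral_rescale` p142701) to a PRIMITIVE INTEGRAL alternating `G₀` (some entry `= 1`, so `red G₀ ≠ 0`), invariant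
under `rint` with the same multiplier, which is therefore integral (read off the unit entry) and a unit
(`ν⁴ det G₀ = det(rint)² det G₀`). [folklore] -/
theorem stub_residualGramForm :
    ∀ (p : ℕ) [Fact p.Prime] (k : Type) [Field k] (Γ : Type) [Group Γ]
      (red : Valued.integer (PadicAlgCl p) →+* k)
      (r : Γ →* GL (Fin 4) (PadicAlgCl p)) (P : GL (Fin 4) (PadicAlgCl p))
      (rint : Γ →* GL (Fin 4) (Valued.integer (PadicAlgCl p)))
      (J : Matrix (Fin 4) (Fin 4) (PadicAlgCl p)) (ν : Γ → PadicAlgCl p),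
      (∀ g, Matrix.GeneralLinearGroup.map (Valued.integer (PadicAlgCl p)).subtype (rint g) = P⁻¹ * r g * P) →
      Jᵀ = -J → J.det ≠ 0 → (∀ g, (r g).valᵀ * J * (r g).val = ν g • J) →
      ∃ (G₀ : Matrix (Fin 4) (Fin 4) (Valued.integer (PadicAlgCl p))) (q : PadicAlgCl p)
        (νi : Γ → Valued.integer (PadicAlgCl p)),
        q ≠ 0 ∧ G₀.map (Valued.integer (PadicAlgCl p)).subtype = q⁻¹ • (P.valᵀ * J * P.val) ∧
        G₀ᵀ = -G₀ ∧ G₀.map red ≠ 0 ∧ (∀ g, ((νi g : Valued.integer (PadicAlgCl p)) : PadicAlgCl p) = ν g) ∧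
        (∀ g, IsUnit (νi g)) ∧ ∀ g, (rint g).valᵀ * G₀ * (rint g).val = νi g • G₀ := by
  intro p _ k _ Γ _ red r P rint J ν hP hJT hJdet hJ
  -- (1) the frame `rint = P⁻¹ r P` over `ℚ̄_p`; the Gram matrix `G = Pᵀ J P` is invertible
  have hPv : ∀ g, (rint g).val.map (Valued.integer (PadicAlgCl p)).subtype = (P⁻¹).val * (r g).val * P.val :=
    fun g => by
      have e := congrArg Units.val (hP g)
      rw [Units.val_mul, Units.val_mul] at e
      exact e
  have hGu : IsUnit (P.valᵀ * J * P.val) := by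
    rw [Matrix.isUnit_iff_isUnit_det, Matrix.det_mul, Matrix.det_mul, Matrix.det_transpose]
    have hPd : IsUnit P.val.det := (Matrix.isUnit_iff_isUnit_det _).mp P.isUnit
    exact (hPd.mul (isUnit_iff_ne_zero.mpr hJdet)).mul hPd
  -- (2) integral rescaling `G₀ = q⁻¹ • G` with an entry `1`
  obtain ⟨q, G₀, i₀, j₀, hq0, hG₀, hone⟩ := exists_integral_rescale hGu.unit
  rw [IsUnit.unit_spec] at hG₀
  -- invariance over `ℚ̄_p`: `(rint g)ᵀ G₀ (rint g) = ν g • G₀` after `map subtype`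
  have hmap : ∀ g, ((rint g).valᵀ * G₀ * (rint g).val).map (Valued.integer (PadicAlgCl p)).subtype =
      ν g • G₀.map (Valued.integer (PadicAlgCl p)).subtype := fun g => by
    rw [Matrix.map_mul, Matrix.map_mul, Matrix.transpose_map, hG₀, Matrix.mul_smul, Matrix.smul_mul, hPv g,
      transpose_conj_mul_form, hJ g, Matrix.mul_smul, Matrix.smul_mul]
    exact smul_comm _ _ _
  -- the integral multiplier: the `(i₀, j₀)` entry of the integral matrix `(rint g)ᵀ G₀ (rint g)`
  obtain ⟨νi, hνi⟩ : ∃ νi : Γ → Valued.integer (PadicAlgCl p),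
      ∀ g, ((νi g : Valued.integer (PadicAlgCl p)) : PadicAlgCl p) = ν g := by
    refine ⟨fun g => ((rint g).valᵀ * G₀ * (rint g).val) i₀ j₀, fun g => ?_⟩
    have e := congrFun (congrFun (hmap g) i₀) j₀
    rw [Matrix.map_apply, Matrix.smul_apply, Matrix.map_apply, hone, map_one, smul_eq_mul, mul_one] at e
    exact e
  -- the invariance descends to `ℤ̄_p`
  have hO : ∀ g, (rint g).valᵀ * G₀ * (rint g).val = νi g • G₀ := fun g => by
    have e : ((rint g).valᵀ * G₀ * (rint g).val).map (Valued.integer (PadicAlgCl p)).subtype =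
        (νi g • G₀).map (Valued.integer (PadicAlgCl p)).subtype := by
      rw [hmap g, Matrix.map_smul' _ _ _ (map_mul (Valued.integer (PadicAlgCl p)).subtype)]
      congr 1
      exact (hνi g).symm
    exact Matrix.map_injective (f := ⇑(Valued.integer (PadicAlgCl p)).subtype) Subtype.val_injective e
  -- (3) antisymmetry descends to `ℤ̄_p`; the reduction is non-zero at the unit entry
  have hG₀T : G₀ᵀ = -G₀ := by
    have e : G₀ᵀ.map (Valued.integer (PadicAlgCl p)).subtype = (-G₀).map (Valued.integer (PadicAlgCl p)).subtype := by
      rw [Matrix.transpose_map, Matrix.map_neg _ (map_neg (Valued.integer (PadicAlgCl p)).subtype), hG₀,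
        Matrix.transpose_smul, transpose_congr_eq_neg P.val J hJT, smul_neg]
    exact Matrix.map_injective (f := ⇑(Valued.integer (PadicAlgCl p)).subtype) Subtype.val_injective e
  have hred0 : G₀.map red ≠ 0 := by
    intro h0
    have e := congrFun (congrFun h0 i₀) j₀
    rw [Matrix.map_apply, hone, map_one, Matrix.zero_apply] at e
    exact one_ne_zero e
  -- (4) `det G₀ ≠ 0`, so every `νi g` is a unit of the domain `ℤ̄_p`
  have hG₀det : G₀.det ≠ 0 := by
    intro h0
    have e : (G₀.map (Valued.integer (PadicAlgCl p)).subtype).det = 0 := by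
      rw [← RingHom.mapMatrix_apply, ← RingHom.map_det, h0, map_zero]
    rw [hG₀, Matrix.det_smul, Fintype.card_fin] at e
    have hGd : (P.valᵀ * J * P.val).det ≠ 0 := ((Matrix.isUnit_iff_isUnit_det _).mp hGu).ne_zero
    exact mul_ne_zero (pow_ne_zero _ (inv_ne_zero hq0)) hGd e
  have hunit : ∀ g, IsUnit (νi g) := fun g =>
    isUnit_multiplier_of_det_ne_zero (rint g) G₀ hG₀det (νi g) (hO g)
  exact ⟨G₀, q, νi, hq0, hG₀, hG₀T, hred0, hνi, hunit, hO⟩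

end Summit.Langlands.Langlands.Cruxes.ResiduallyYoshidaLifting.SectorKlingenSplit.Fibre

end
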